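import Summits.AtomisticToContinuum.HydrodynamicLimit.Theses.SpeedCapSurgery
import Summits.AtomisticToContinuum.HydrodynamicLimit.Theorems.SpeedCapSurgeryMaxSpeedBoundLogInitialSpeedTailLog
import Summits.AtomisticToContinuum.HydrodynamicLimit.Theorems.SpeedCapSurgeryMaxSpeedBoundLogEnergeticCollisionRecord
import Summits.AtomisticToContinuum.HydrodynamicLimit.Theorems.SpeedCapSurgeryMaxSpeedBoundLogEquilibriumRare
import HarnessLib

/-!
# `EquilibriumMaxSpeed` (stmt-9632) and the speed-cap composition of the `MaxSpeedBoundLog` line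

This file CLOSES the route item `EquilibriumMaxSpeed` (stmt-AtomisticToContinuum-9632, the calibration
of the crux `MaxSpeedBoundLog` at constant profiles) — `equilibriumMaxSpeed_proof` at the end — and,
on the way, records as importable theorems the kernel-checked COMPOSITION of the crux line `registered`
(birth skeleton `Cruxes/MaxSpeedBoundLog/Lines/birth.lean` of stmt-AtomisticToContinuum-9629) (there
`speedEvent_measure_le` / `MaxSpeedBoundLog_of`, by the skeleton registrar), in a per-instance form
whose three hypotheses are the three stub statements AT FIXED profiles `(a₀, u₀, θ₀)`, reduced
density `σ`, horizon `t` and flow family `Φ` — so that the same composition serves the crux (all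
continuous positive profiles), its calibration `EquilibriumMaxSpeed` (constant profiles, stmt-9632)
and the glue `TailsToMaxSpeedR` (stmt-16990):

* `speedEvent_measure_le` — PER-`N` UNION BOUND: for a threshold `c`, a measurable majorant `g` of
  the number of collision times in `(0,t]` with colliding-pair energy above `c²` on good orbits, and
  the record property at level `c`, the law of "some sphere faster than `c` at some `r ∈ [0,t]`" is at
  most the law of "some sphere faster than `c` at time `0`" plus `∫⁻ g`
  (`E ⊆ A ∪ goodᶜ ∪ {1 ≤ g}`, `LG(goodᶜ) = 0`, Markov, subadditivity);
* `exists_speedCap_of` — given (1) a static tail `LG_N{∃ i, C₀√log(N+2) < ‖vᵢ‖} → 0`, (2) the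
  record lemma on good orbits and (3) `C₁ ≥ 0` with measurable majorants `g N` of the energetic
  collision count at level `C₁√log(N+2)` with `∫⁻ g N dLG_N → 0`, the speed cap holds with
  `C = max C₀ C₁`: `LG_N{∃ r ∈ [0,t], ∃ i, C√log(N+2) < ‖vᵢ(Φ_N(r) z)‖} → 0` (monotonicity of both
  events in the constant, squeeze in `ℝ≥0∞`).

No new definitions; the local Gibbs law enters only through `localGibbsLaw = liouville.withDensity _`.
-/

noncomputable section

open MeasureTheory Set Filter Topology
open scoped ENNReal

namespace Summit.AtomisticToContinuum.HydrodynamicLimit.Theorems.MaxSpeedBoundLogLine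

open Literature.MathematicalPhysics.KineticTheory Literature.Analysis.FluidPDE

/-- **Per-`N` union bound** (the measure-theoretic core of the line's composition; adapted from the
registered skeleton `Cruxes/MaxSpeedBoundLog/Lines/birth.lean`): for a threshold `c`, a measurable
majorant `g` of the number of collision times in `(0,t]` with colliding-pair energy above `c²` on good
orbits, and the record property at level `c`, the law of "some sphere faster than `c` at some
`r ∈ [0,t]`" is at most the law of "some sphere faster than `c` at time `0`" plus `∫⁻ g`:
`E ⊆ A ∪ goodᶜ ∪ {1 ≤ g}` (record lemma; the energetic collision times form a subset of the locally
finite collision times, so a nonempty one has `1 ≤ ncard ≤ g`), `LG(goodᶜ) = 0`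
(`localGibbsLaw = liouville.withDensity _ ≪ liouville`, `measure_compl_good`), Markov
`LG{1 ≤ g} ≤ ∫⁻ g dLG`, subadditivity. -/
theorem speedEvent_measure_le (σ : ℝ) (a₀ θ₀ : T3 → ℝ) (u₀ : T3 → V3) (N : ℕ)
    (Φ : HardSphereFlow (Torus.geometry (Fin 3)) (hsDiameter σ N) (N + 1))
    (c t : ℝ) (g : Config (N + 1) (Fin 3) T3 → ℝ≥0∞) (hgm : Measurable g)
    (hgc : ∀ z ∈ Φ.good,
      ((Set.ncard {r ∈ Set.Ioc 0 t | ∃ i j : Fin (N + 1), i ≠ j ∧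
          Φ.flow r z ∈ contactSet (Torus.geometry (Fin 3)) (N + 1) (hsDiameter σ N) i j ∧
          c ^ 2 < ‖(Φ.flow r z i).2‖ ^ 2 + ‖(Φ.flow r z j).2‖ ^ 2} : ℕ) : ℝ≥0∞) ≤ g z)
    (hRecord : ∀ z ∈ Φ.good, (∀ i, ‖(z i).2‖ ≤ c) →
      (∃ r ∈ Set.Icc 0 t, ∃ i, c < ‖(Φ.flow r z i).2‖) →
      ∃ r ∈ Set.Ioc 0 t, ∃ i j : Fin (N + 1), i ≠ j ∧
        Φ.flow r z ∈ contactSet (Torus.geometry (Fin 3)) (N + 1) (hsDiameter σ N) i j ∧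
        c ^ 2 < ‖(Φ.flow r z i).2‖ ^ 2 + ‖(Φ.flow r z j).2‖ ^ 2) :
    localGibbsLaw σ a₀ u₀ θ₀ N Φ {z | ∃ r ∈ Set.Icc 0 t, ∃ i, c < ‖(Φ.flow r z i).2‖}
      ≤ localGibbsLaw σ a₀ u₀ θ₀ N Φ {z | ∃ i, c < ‖(z i).2‖}
        + ∫⁻ z, g z ∂(localGibbsLaw σ a₀ u₀ θ₀ N Φ) := by
  -- adapted from Cruxes/MaxSpeedBoundLog/Lines/birth.lean (skeleton registrar)
  set μ := localGibbsLaw σ a₀ u₀ θ₀ N Φ with hμ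
  -- step 1: the set inclusion `E ⊆ (A ∪ goodᶜ) ∪ {1 ≤ g}`
  have hsub : {z | ∃ r ∈ Set.Icc 0 t, ∃ i, c < ‖(Φ.flow r z i).2‖}
      ⊆ ({z | ∃ i, c < ‖(z i).2‖} ∪ (Φ.good)ᶜ) ∪ {z | (1 : ℝ≥0∞) ≤ g z} := by
    intro z hz
    by_cases hA : z ∈ {z | ∃ i, c < ‖(z i).2‖}
    · exact Or.inl (Or.inl hA)
    by_cases hgood : z ∈ Φ.good
    · right
      have hA' : ∀ i, ‖(z i).2‖ ≤ c := fun i => not_lt.mp fun h => hA ⟨i, h⟩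
      obtain ⟨r, hr, i, j, hij, hcontact, hE⟩ := hRecord z hgood hA' hz
      have hfin : {r ∈ Set.Ioc 0 t | ∃ i j : Fin (N + 1), i ≠ j ∧
          Φ.flow r z ∈ contactSet (Torus.geometry (Fin 3)) (N + 1) (hsDiameter σ N) i j ∧
          c ^ 2 < ‖(Φ.flow r z i).2‖ ^ 2 + ‖(Φ.flow r z j).2‖ ^ 2}.Finite := by
        refine ((Φ.isTrajectory z hgood).locFinite 0 t).subset ?_
        intro r' hr'
        obtain ⟨i', j', hij', hc', -⟩ := hr'.2
        exact ⟨⟨i', j', hij', hc'⟩, Set.Ioc_subset_Icc_self hr'.1⟩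
      have hne : {r ∈ Set.Ioc 0 t | ∃ i j : Fin (N + 1), i ≠ j ∧
          Φ.flow r z ∈ contactSet (Torus.geometry (Fin 3)) (N + 1) (hsDiameter σ N) i j ∧
          c ^ 2 < ‖(Φ.flow r z i).2‖ ^ 2 + ‖(Φ.flow r z j).2‖ ^ 2}.Nonempty :=
        ⟨r, hr, i, j, hij, hcontact, hE⟩
      have hpos := (Set.ncard_pos hfin).mpr hne
      have h1 : (1 : ℝ≥0∞) ≤ ((Set.ncard {r ∈ Set.Ioc 0 t | ∃ i j : Fin (N + 1), i ≠ j ∧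
          Φ.flow r z ∈ contactSet (Torus.geometry (Fin 3)) (N + 1) (hsDiameter σ N) i j ∧
          c ^ 2 < ‖(Φ.flow r z i).2‖ ^ 2 + ‖(Φ.flow r z j).2‖ ^ 2} : ℕ) : ℝ≥0∞) := by
        exact_mod_cast hpos
      exact le_trans h1 (hgc z hgood)
    · exact Or.inl (Or.inr hgood)
  -- step 2: bad initial data are Liouville-null, hence null for the local Gibbs law
  have hnull : μ (Φ.good)ᶜ = 0 := by
    rw [hμ]
    exact MeasureTheory.withDensity_absolutelyContinuous _ _ Φ.measure_compl_good
  -- step 3: Markov at level 1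
  have hmarkov : μ {z | (1 : ℝ≥0∞) ≤ g z} ≤ ∫⁻ z, g z ∂μ := by
    have := MeasureTheory.mul_meas_ge_le_lintegral₀ hgm.aemeasurable (1 : ℝ≥0∞) (μ := μ)
    simpa using this
  calc μ {z | ∃ r ∈ Set.Icc 0 t, ∃ i, c < ‖(Φ.flow r z i).2‖}
      ≤ μ (({z | ∃ i, c < ‖(z i).2‖} ∪ (Φ.good)ᶜ) ∪ {z | (1 : ℝ≥0∞) ≤ g z}) :=
        MeasureTheory.measure_mono hsub
    _ ≤ μ ({z | ∃ i, c < ‖(z i).2‖} ∪ (Φ.good)ᶜ) + μ {z | (1 : ℝ≥0∞) ≤ g z} :=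
        MeasureTheory.measure_union_le _ _
    _ ≤ (μ {z | ∃ i, c < ‖(z i).2‖} + μ (Φ.good)ᶜ) + μ {z | (1 : ℝ≥0∞) ≤ g z} := by
        gcongr
        exact MeasureTheory.measure_union_le _ _
    _ ≤ μ {z | ∃ i, c < ‖(z i).2‖} + ∫⁻ z, g z ∂μ := by
        rw [hnull, add_zero]
        gcongr

/-- **The speed cap from the three statements of the line, per instance** (adapted from the
composition `MaxSpeedBoundLog_of` of the registered skeleton). Fix profiles `(a₀, u₀, θ₀)`, a
reduced density `σ`, a horizon `t` and a flow family `Φ`. Given (1) the static tail: some `C₀` with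
`LG_N{∃ i, C₀√log(N+2) < ‖vᵢ‖} → 0`; (2) the record lemma on good orbits: a speed above `c` absent
at time `0` and present at some `r ∈ [0,t]` is set at a collision time in `(0,t]` whose colliding
pair has kinetic energy above `c²`; (3) `C₁ ≥ 0` and measurable majorants `g N` of the number of such
energetic collision times at level `C₁√log(N+2)`, with `∫⁻ g N dLG_N → 0` — the cap holds with
`C = max C₀ C₁`: `speedEvent_measure_le` at level `C√log(N+2)` (with `g N`, a majorant also at level
`C` because the energetic count is antitone in the level), monotonicity of the time-`0` event in the
constant, and a squeeze in `ℝ≥0∞`. -/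
theorem exists_speedCap_of {σ : ℝ} {a₀ θ₀ : T3 → ℝ} {u₀ : T3 → V3} {t : ℝ}
    {Φ : (N : ℕ) → HardSphereFlow (Torus.geometry (Fin 3)) (hsDiameter σ N) (N + 1)}
    (hTail : ∃ C₀ : ℝ, Tendsto (fun N : ℕ => localGibbsLaw σ a₀ u₀ θ₀ N (Φ N)
      {z | ∃ i, C₀ * Real.sqrt (Real.log ((N : ℝ) + 2)) < ‖(z i).2‖}) atTop (𝓝 0))
    (hRecord : ∀ (N : ℕ) (z : Config (N + 1) (Fin 3) T3), z ∈ (Φ N).good → ∀ c : ℝ,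
      (∀ i, ‖(z i).2‖ ≤ c) → (∃ r ∈ Set.Icc 0 t, ∃ i, c < ‖((Φ N).flow r z i).2‖) →
      ∃ r ∈ Set.Ioc 0 t, ∃ i j : Fin (N + 1), i ≠ j ∧
        (Φ N).flow r z ∈ contactSet (Torus.geometry (Fin 3)) (N + 1) (hsDiameter σ N) i j ∧
        c ^ 2 < ‖((Φ N).flow r z i).2‖ ^ 2 + ‖((Φ N).flow r z j).2‖ ^ 2)
    (hRare : ∃ C₁ : ℝ, 0 ≤ C₁ ∧ ∃ g : (N : ℕ) → Config (N + 1) (Fin 3) T3 → ℝ≥0∞,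
      (∀ N, Measurable (g N)) ∧
      (∀ N, ∀ z ∈ (Φ N).good,
        ((Set.ncard {r ∈ Set.Ioc 0 t | ∃ i j : Fin (N + 1), i ≠ j ∧
            (Φ N).flow r z ∈ contactSet (Torus.geometry (Fin 3)) (N + 1) (hsDiameter σ N) i j ∧
            (C₁ * Real.sqrt (Real.log ((N : ℝ) + 2))) ^ 2 <
              ‖((Φ N).flow r z i).2‖ ^ 2 + ‖((Φ N).flow r z j).2‖ ^ 2} : ℕ) : ℝ≥0∞) ≤ g N z) ∧
      Tendsto (fun N : ℕ => ∫⁻ z, g N z ∂(localGibbsLaw σ a₀ u₀ θ₀ N (Φ N))) atTop (𝓝 0)) :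
    ∃ C : ℝ, Tendsto (fun N : ℕ => localGibbsLaw σ a₀ u₀ θ₀ N (Φ N)
      {z | ∃ r ∈ Set.Icc 0 t, ∃ i, C * Real.sqrt (Real.log ((N : ℝ) + 2)) < ‖((Φ N).flow r z i).2‖})
      atTop (𝓝 0) := by
  -- adapted from Cruxes/MaxSpeedBoundLog/Lines/birth.lean (`MaxSpeedBoundLog_of`)
  obtain ⟨C₀, hT⟩ := hTail
  obtain ⟨C₁, hC₁, g, hgm, hgc, hgt⟩ := hRare
  refine ⟨max C₀ C₁, ?_⟩
  have hC0 : C₀ ≤ max C₀ C₁ := le_max_left _ _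
  have hC1 : C₁ ≤ max C₀ C₁ := le_max_right _ _
  have hlev : ∀ N : ℕ, C₀ * Real.sqrt (Real.log ((N : ℝ) + 2)) ≤
      max C₀ C₁ * Real.sqrt (Real.log ((N : ℝ) + 2)) :=
    fun N => mul_le_mul_of_nonneg_right hC0 (Real.sqrt_nonneg _)
  have hlev2 : ∀ N : ℕ, (C₁ * Real.sqrt (Real.log ((N : ℝ) + 2))) ^ 2
      ≤ (max C₀ C₁ * Real.sqrt (Real.log ((N : ℝ) + 2))) ^ 2 := by
    intro N
    have hs : 0 ≤ Real.sqrt (Real.log ((N : ℝ) + 2)) := Real.sqrt_nonneg _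
    rw [sq, sq]
    exact mul_self_le_mul_self (mul_nonneg hC₁ hs) (mul_le_mul_of_nonneg_right hC1 hs)
  have hbound : ∀ N : ℕ,
      localGibbsLaw σ a₀ u₀ θ₀ N (Φ N)
          {z | ∃ r ∈ Set.Icc 0 t, ∃ i, max C₀ C₁ * Real.sqrt (Real.log ((N : ℝ) + 2)) <
            ‖((Φ N).flow r z i).2‖}
        ≤ localGibbsLaw σ a₀ u₀ θ₀ N (Φ N)
            {z | ∃ i, C₀ * Real.sqrt (Real.log ((N : ℝ) + 2)) < ‖(z i).2‖}
          + ∫⁻ z, g N z ∂(localGibbsLaw σ a₀ u₀ θ₀ N (Φ N)) := by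
    intro N
    refine le_trans (speedEvent_measure_le σ a₀ θ₀ u₀ N (Φ N)
      (max C₀ C₁ * Real.sqrt (Real.log ((N : ℝ) + 2))) t (g N) (hgm N) ?_
      (fun z hz => hRecord N z hz (max C₀ C₁ * Real.sqrt (Real.log ((N : ℝ) + 2))))) ?_
    · -- `g N` majorises the level-`C` count because it majorises the (larger) level-`C₁` count
      intro z hz
      refine le_trans ?_ (hgc N z hz)
      have hfin : {r ∈ Set.Ioc 0 t | ∃ i j : Fin (N + 1), i ≠ j ∧
          (Φ N).flow r z ∈ contactSet (Torus.geometry (Fin 3)) (N + 1) (hsDiameter σ N) i j ∧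
          (C₁ * Real.sqrt (Real.log ((N : ℝ) + 2))) ^ 2 <
            ‖((Φ N).flow r z i).2‖ ^ 2 + ‖((Φ N).flow r z j).2‖ ^ 2}.Finite := by
        refine (((Φ N).isTrajectory z hz).locFinite 0 t).subset ?_
        intro r' hr'
        obtain ⟨i', j', hij', hc', -⟩ := hr'.2
        exact ⟨⟨i', j', hij', hc'⟩, Set.Ioc_subset_Icc_self hr'.1⟩
      have hsubset : {r ∈ Set.Ioc 0 t | ∃ i j : Fin (N + 1), i ≠ j ∧
          (Φ N).flow r z ∈ contactSet (Torus.geometry (Fin 3)) (N + 1) (hsDiameter σ N) i j ∧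
          (max C₀ C₁ * Real.sqrt (Real.log ((N : ℝ) + 2))) ^ 2 <
            ‖((Φ N).flow r z i).2‖ ^ 2 + ‖((Φ N).flow r z j).2‖ ^ 2}
        ⊆ {r ∈ Set.Ioc 0 t | ∃ i j : Fin (N + 1), i ≠ j ∧
          (Φ N).flow r z ∈ contactSet (Torus.geometry (Fin 3)) (N + 1) (hsDiameter σ N) i j ∧
          (C₁ * Real.sqrt (Real.log ((N : ℝ) + 2))) ^ 2 <
            ‖((Φ N).flow r z i).2‖ ^ 2 + ‖((Φ N).flow r z j).2‖ ^ 2} := by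
        intro r' hr'
        obtain ⟨i', j', hij', hc', hE'⟩ := hr'.2
        exact ⟨hr'.1, i', j', hij', hc', lt_of_le_of_lt (hlev2 N) hE'⟩
      exact_mod_cast Set.ncard_le_ncard hsubset hfin
    · -- the time-`0` event shrinks as the constant grows
      refine add_le_add ?_ le_rfl
      refine MeasureTheory.measure_mono fun z hz => ?_
      obtain ⟨i, hi⟩ := hz
      exact ⟨i, lt_of_le_of_lt (hlev N) hi⟩
  have hsum : Tendsto (fun N : ℕ =>
      localGibbsLaw σ a₀ u₀ θ₀ N (Φ N)
          {z | ∃ i, C₀ * Real.sqrt (Real.log ((N : ℝ) + 2)) < ‖(z i).2‖}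
        + ∫⁻ z, g N z ∂(localGibbsLaw σ a₀ u₀ θ₀ N (Φ N))) atTop (𝓝 0) := by
    simpa using hT.add hgt
  exact tendsto_of_tendsto_of_tendsto_of_le_of_le tendsto_const_nhds hsum (fun N => bot_le) hbound

/-! ## `EquilibriumMaxSpeed` -/

/-- **`EquilibriumMaxSpeed` (stmt-AtomisticToContinuum-9632), the calibration of the crux
`MaxSpeedBoundLog` at constant profiles `a₀ ≡ 1`, `u₀ ≡ 0`, `θ₀ ≡ θe`.** Under the homogeneous
canonical Gibbs law (flow-invariant) the max speed on `[0, t]` exceeds `C√log(N+2)` with probability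
`→ 0` for some `C`, for every `0 < σ < 1/2`, `t ≥ 0` and flow family: the composition
`exists_speedCap_of` fed with the landed static tail `stub_initialSpeedTailLog` (constant profiles are
continuous and positive), the landed pathwise record lemma `stub_energeticCollisionRecord`, and the
equilibrium first-moment bound `equilibrium_energeticCollisionsRare` (`σ₀ = 1/2`). -/
theorem equilibriumMaxSpeed_proof :
    Summit.AtomisticToContinuum.HydrodynamicLimit.Theses.SpeedCapSurgery.EquilibriumMaxSpeed := by
  intro θe hθe
  obtain ⟨σ₀, hσ₀, H⟩ := equilibrium_energeticCollisionsRare θe hθe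
  refine ⟨σ₀, hσ₀, fun σ hσ hσlt t ht Φ => ?_⟩
  exact exists_speedCap_of
    (Summit.AtomisticToContinuum.HydrodynamicLimit.Cruxes.MaxSpeedBoundLog.Birth.stub_initialSpeedTailLog
      (fun _ => 1) (fun _ => θe) (fun _ => 0) continuous_const continuous_const continuous_const
      (fun _ => one_pos) (fun _ => hθe) σ hσ Φ)
    (fun N z hz c =>
      Summit.AtomisticToContinuum.HydrodynamicLimit.Theorems.MaxSpeedBoundLogBirth.stub_energeticCollisionRecord
        σ N (Φ N) z hz c t)
    (H σ hσ hσlt t ht Φ)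

end Summit.AtomisticToContinuum.HydrodynamicLimit.Theorems.MaxSpeedBoundLogLine

end
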